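import Summits.CriticalPhenomena.PercolationContinuityZ3.Theorems.PercAnnulusCrossingIICLocalLimit
import Summits.CriticalPhenomena.PercolationContinuityZ3.Theorems.PercNearOneGluingNoHeavyQuantOneArm
import HarnessLib

/-!
# The IIC local limit at a polynomial rate under (A2)□ and (T1): `|ν(E) − P_{p_c}(E)| ≤ C · Σ_{w} ‖w‖_∞^{−c}` (lane RSW3, p1 gen 7)

builds on p205010 (kernel theorem, internal audit signed; external expert review pending) — used only through the (A2)□ ⇒ one-arm
quasi-multiplicativity bridge (`PercAnnulusCrossingIICLocalLimit.lean`).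

Seat `prim-rsw3-p1` (gen 7).  CONDITIONAL, typed in the lane's hypotheses: (A2)□ at one aspect (`SetToSetQuasiMultAspectAt`) and the
QUANT lane's polynomial one-arm decay (T1) `Quant.OneArmPolyDecayAtCritical d c C₁` (`π_{p_c}(n) ≤ C₁ n^{−c}`, OPEN at `d = 3`).
Under both, `iicMeasure_abs_real_sub_le_criticalProbI` (`|ν(E) − P_{p_c}(E)| ≤ C₀ Σ_{w} π_{p_c}(⌊(‖w‖_∞−1)/2⌋)`) becomes an explicit
polynomial rate in the distance of the window from the root:

* `rpow_half_floor_le` — `⌊(n−1)/2⌋^{−c} ≤ 4^c · n^{−c}` for `n ≥ 7`, `c ≥ 0`;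
* **`iicMeasure_abs_real_sub_le_rpow_of_oneArmPolyDecay`** — at `p_c(ℤ^d)`, `d ≥ 2`, under (A2)□ at aspect `(s,L)` and (T1) with exponent
  `c > 0`: `∃ C > 0 ∀ ν ∀ F W E` (endpoints of `F` in `W`, sup-norms `≥ 7`): **`|ν(E) − P_{p_c}(E)| ≤ C · Σ_{w ∈ W} ‖w‖_∞^{−c}`**.
The planar, unconditional instance (exponent `2^{−158}`) is `PercAnnulusCrossingIICLocalLimitPlanarRate.lean`.

Helper file for the crux `stmt-CriticalPhenomena-4575` chain; no definitions, no sorries.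
References: H. Kesten, PTRF 73 (1986) 369–394, (1.12)–(1.13); D. Basu, A. Sapozhnikov, ECP 22 (2017) no. 26, §1 (A2).
-/

noncomputable section

namespace Summit.CriticalPhenomena.PercolationContinuityZ3.Theorems.Crossing

open MeasureTheory ProbabilityTheory Filter Topology
open Literature.Probability.Percolation Literature.Probability.LatticeModels
open Literature.Probability.Percolation.DCT16
open scoped ENNReal ProbabilityTheory Literature.Probability.Percolation

variable {d : ℕ}

/-- `⌊(n−1)/2⌋^{−c} ≤ 4^c · n^{−c}` for `n ≥ 7` and `c ≥ 0` (`⌊(n−1)/2⌋ ≥ n/4`). [folklore] -/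
theorem rpow_half_floor_le {n : ℕ} (hn : 7 ≤ n) {c : ℝ} (hc : 0 ≤ c) :
    ((((n - 1) / 2 : ℕ) : ℝ)) ^ (-c) ≤ (4 : ℝ) ^ c * (n : ℝ) ^ (-c) := by
  have hk : (n : ℝ) / 4 ≤ (((n - 1) / 2 : ℕ) : ℝ) := by
    have h1 : n ≤ 4 * ((n - 1) / 2) := by omega
    have h2 : (n : ℝ) ≤ 4 * (((n - 1) / 2 : ℕ) : ℝ) := by exact_mod_cast h1
    linarith
  have hn0 : (0 : ℝ) < n := by exact_mod_cast (show 0 < n by omega)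
  have hpos : (0 : ℝ) < (n : ℝ) / 4 := by positivity
  calc ((((n - 1) / 2 : ℕ) : ℝ)) ^ (-c) ≤ ((n : ℝ) / 4) ^ (-c) := Real.rpow_le_rpow_of_nonpos hpos hk (by linarith)
    _ = (4 : ℝ) ^ c * (n : ℝ) ^ (-c) := by
        rw [Real.div_rpow hn0.le (by norm_num), Real.rpow_neg (by norm_num : (0 : ℝ) ≤ 4), div_inv_eq_mul, mul_comm]

/-- **THE IIC LOCAL LIMIT AT A POLYNOMIAL RATE (ℤ^d, under (A2)□ and (T1))**: at `p_c(ℤ^d)`, `d ≥ 2`, under (A2)□ at aspect `(s,L)`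
(`2 ≤ s ≤ L`, `ϰ > 0`) and the polynomial one-arm decay `Quant.OneArmPolyDecayAtCritical d c C₁` (`c > 0`), there is `C > 0` such that
for every measure `ν` with Kesten's IIC limit property, every finite edge set `F` with endpoints in `W`, all of sup-norm `≥ 7`, and every
event `E` determined by `F`: **`|ν(E) − P_{p_c}(E)| ≤ C · Σ_{w ∈ W} ‖w‖_∞^{−c}`**.
[cite: Kesten1986, (1.12)–(1.13)] [cite: BasuSapozhnikov2017ECP, Thm. 1.1 and §1 (A2)] -/
theorem iicMeasure_abs_real_sub_le_rpow_of_oneArmPolyDecay (hd : 2 ≤ d) {s L : ℕ} (hs : 2 ≤ s) (hsL : s ≤ L) {ϰ : ℝ} (hϰ : 0 < ϰ)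
    (hA2 : SetToSetQuasiMultAspectAt d (criticalProbI d) s L ϰ) {c C₁ : ℝ} (hc : 0 < c)
    (hT1 : Quant.OneArmPolyDecayAtCritical d c C₁) :
    ∃ C : ℝ, 0 < C ∧ ∀ (ν : Measure (BondConfig (Site d))),
      (∀ (F : Finset (Sym2 (Site d))) (E : Set (BondConfig (Site d))), MeasurableSet E → DeterminedBy E ↑F →
        Tendsto (fun n : ℕ => (bondPercolation (zdGraph d) (criticalProbI d)).real (E ∩ siteToBoundary d n) /
          oneArmProb d (criticalProbI d) n) atTop (𝓝 (ν.real E))) →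
      ∀ (F : Finset (Sym2 (Site d))) (W : Finset (Site d)) (E : Set (BondConfig (Site d))),
        (∀ e ∈ F, ∀ w ∈ e, w ∈ W) → (∀ w ∈ W, 7 ≤ Site.supNorm w) → DeterminedBy E ↑F →
        |ν.real E - (bondPercolation (zdGraph d) (criticalProbI d)).real E| ≤
          C * ∑ w ∈ W, (Site.supNorm w : ℝ) ^ (-c) := by
  obtain ⟨C₀, hC₀, hb⟩ := iicMeasure_abs_real_sub_le_criticalProbI hd hs hsL hϰ hA2
  set C₂ : ℝ := max C₁ 1 with hC₂
  have hC₂0 : 0 < C₂ := lt_max_of_lt_right one_pos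
  refine ⟨C₀ * (C₂ * (4 : ℝ) ^ c), by positivity, fun ν hν F W E hFW hW hE => ?_⟩
  refine (hb ν hν F W E hFW hW hE).trans ?_
  have hterm : ∀ w ∈ W, oneArmProb d (criticalProbI d) ((Site.supNorm w - 1) / 2) ≤
      C₂ * (4 : ℝ) ^ c * (Site.supNorm w : ℝ) ^ (-c) := by
    intro w hw
    set n := Site.supNorm w with hn
    have hn7 : 7 ≤ n := hW w hw
    have hk1 : 1 ≤ (n - 1) / 2 := by omega
    -- (T1) at the scale `⌊(n−1)/2⌋`
    have h1 : oneArmProb d (criticalProbI d) ((n - 1) / 2) ≤ C₁ * ((((n - 1) / 2 : ℕ) : ℝ)) ^ (-c) := hT1 _ hk1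
    have hr0 : 0 ≤ ((((n - 1) / 2 : ℕ) : ℝ)) ^ (-c) := Real.rpow_nonneg (Nat.cast_nonneg _) _
    have h2 : C₁ * ((((n - 1) / 2 : ℕ) : ℝ)) ^ (-c) ≤ C₂ * ((((n - 1) / 2 : ℕ) : ℝ)) ^ (-c) :=
      mul_le_mul_of_nonneg_right (le_max_left _ _) hr0
    have h3 := rpow_half_floor_le hn7 hc.le
    calc oneArmProb d (criticalProbI d) ((n - 1) / 2) ≤ C₂ * ((((n - 1) / 2 : ℕ) : ℝ)) ^ (-c) := h1.trans h2
      _ ≤ C₂ * ((4 : ℝ) ^ c * (n : ℝ) ^ (-c)) := mul_le_mul_of_nonneg_left h3 hC₂0.le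
      _ = C₂ * (4 : ℝ) ^ c * (n : ℝ) ^ (-c) := by ring
  calc C₀ * ∑ w ∈ W, oneArmProb d (criticalProbI d) ((Site.supNorm w - 1) / 2)
      ≤ C₀ * ∑ w ∈ W, C₂ * (4 : ℝ) ^ c * (Site.supNorm w : ℝ) ^ (-c) :=
        mul_le_mul_of_nonneg_left (Finset.sum_le_sum hterm) hC₀.le
    _ = C₀ * (C₂ * (4 : ℝ) ^ c) * ∑ w ∈ W, (Site.supNorm w : ℝ) ^ (-c) := by
        rw [← Finset.mul_sum]
        ring

end Summit.CriticalPhenomena.PercolationContinuityZ3.Theorems.Crossing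

end
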